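import Summits.AtomisticToContinuum.FouriersLaw.Theorems.HonestZwanzigRobinCoercivityResidues

/-!
# `HonestZwanzig.RobinCoercivity`, line `limit-operator-memory-form` — the flux-row bound from band-domination + a diagonal bound

Support file for the crux `stmt-AtomisticToContinuum-12695` (`RobinCoercivity` of route `HonestZwanzig`). The glue theorem
`Robin.robinCoercivity_iff_residues` (…Residues) uses the flux-row bound `FluxRowBound` (`|(W_N(s)u)_i| ≤ C`). Since `u` has entries
`±1`, it follows at once from (U′) `BlockBandDomination` (uniform off-diagonal ℓ¹ row bound `τ 0`) and a uniform bound on the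
DIAGONAL of the block memory matrix, `BlockDiagBound` (`|W_N(s)_{ii}| ≤ C`: the local conductivities `schur_s(j_b, j_b) ≥ 0` of the
clamped dynamics and the two renormalised contact entries `γT² − γ²schur_s(p_c², p_c²) ≤ γT²` — rank-2 / `OrthogonalOhm`
boundedness class; in the bulk already implied by (L)). Hence the residue picture reads: modulo {(U′), (L), `BlockDiagBound`} the crux
`RobinCoercivity` is equivalent to (Q1) ∧ (Q2) (`robinCoercivity_iff_residues'`).
-/

noncomputable section

open MeasureTheory Finset Matrix Filter Topology
open Literature.MathematicalPhysics.KineticTheory.HeatConduction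
open Summit.AtomisticToContinuum.FouriersLaw.Theses.HonestZwanzig

namespace Summit.AtomisticToContinuum.FouriersLaw.Theorems.HonestZwanzig.Robin

/-- **Diagonal bound** (rank-2 / `OrthogonalOhm` boundedness class, open): for `pinnedChain ω₂ lam β γ` (all `> 0`) and `T > 0`
there is `C` with `|W_N(s)_{ii}| ≤ C` for every `N ≥ 2`, all small `s > 0` and every position `i` (bond diagonal = local clamped
conductivity `schur_s(j_{i−1}, j_{i−1}) ≥ 0`; contact diagonal `= γT² − γ²schur_s(p_c², p_c²) ≤ γT²`). -/
def BlockDiagBound : Prop :=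
  ∀ ω₂ lam β γ : ℝ, 0 < ω₂ → 0 < lam → 0 < β → 0 < γ → ∀ T : ℝ, 0 < T → ∃ C : ℝ, ∀ N : ℕ, 2 ≤ N → ∃ s₀ : ℝ, 0 < s₀ ∧ ∀
    (lap : ℝ → (PhaseSpace N → ℝ) → (PhaseSpace N → ℝ) → ℝ) (e : Fin N → PhaseSpace N → ℝ) (G : ℝ → Matrix (Fin N)
    (Fin N) ℝ) (schur : ℝ → (PhaseSpace N → ℝ) → (PhaseSpace N → ℝ) → ℝ) (g : Fin (N + 1) → PhaseSpace N → ℝ) (W : ℝ →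
    Fin (N + 1) → Fin (N + 1) → ℝ), (∀ s f₁ f₂, lap s f₁ f₂ = ∫ t in Set.Ioi (0 : ℝ), Real.exp (-(s * t)) * ((∫ z, f₁
    z * (∫ y, f₂ y ∂((pinnedChain ω₂ lam β γ).transitionKernel N T T t.toNNReal z)) ∂(pinnedChain ω₂ lam β
    γ).gibbsMeasure N T) - (∫ z, f₁ z ∂(pinnedChain ω₂ lam β γ).gibbsMeasure N T) * (∫ z, f₂ z ∂(pinnedChain ω₂ lam β
    γ).gibbsMeasure N T))) → (∀ x z, e x z = z.2 x ^ 2 / 2 + (pinnedChain ω₂ lam β γ).U (z.1 x) + ∑ j : Fin N, ((if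
    j.val = x.val + 1 then (pinnedChain ω₂ lam β γ).V (z.1 j - z.1 x) / 2 else 0) + (if x.val = j.val + 1 then
    (pinnedChain ω₂ lam β γ).V (z.1 x - z.1 j) / 2 else 0))) → (∀ s, G s = Matrix.of fun x y => lap s (e x) (e y)) →
    (∀ s f₁ f₂, schur s f₁ f₂ = lap s f₁ f₂ - ∑ x, ∑ y, lap s f₁ (e x) * (G s)⁻¹ x y * lap s (e y) f₂) → (∀ i z, g i z
    = (∑ b : Fin N, if b.val + 1 = i.val then (pinnedChain ω₂ lam β γ).bondCurrent N b z else 0) + (∑ x : Fin N, if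
    (i.val = 0 ∧ x.val = 0) ∨ (i.val = N ∧ x.val + 1 = N) then (pinnedChain ω₂ lam β γ).γ * (T - z.2 x ^ 2) else 0)) →
    (∀ s i j, W s i j = (if i = j ∧ (i.val = 0 ∨ i.val = N) then (pinnedChain ω₂ lam β γ).γ * T ^ 2 else 0) - schur s
    (fun z => g i (z.1, -z.2)) (g j)) → ∀ s : ℝ, 0 < s → s < s₀ → ∀ i : Fin (N + 1), |W s i i| ≤ C


/-- **`FluxRowBound` from (U′) and the diagonal bound**: `|(Wu)_i| ≤ |W_ii| + Σ_{j ≠ i}|W_ij| ≤ C + τ 0`. -/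
theorem fluxRowBound_of_band_diag (hU : BlockBandDomination) (hD : BlockDiagBound) : FluxRowBound := by
  unfold BlockBandDomination at hU
  unfold BlockDiagBound at hD
  intro ω₂ lam β γ hω hl hβ hγ T hT
  obtain ⟨τ, -, hτN⟩ := hU ω₂ lam β γ hω hl hβ hγ T hT
  obtain ⟨C, hCN⟩ := hD ω₂ lam β γ hω hl hβ hγ T hT
  refine ⟨C + τ 0, fun N hN => ?_⟩
  obtain ⟨s₁, hs₁, h1⟩ := hτN N hN
  obtain ⟨s₂, hs₂, h2⟩ := hCN N hN
  refine ⟨min s₁ s₂, lt_min hs₁ hs₂, ?_⟩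
  intro lap e G schur g W hlap he hG hschur hg hW s hs hss i
  have hb := h1 lap e G schur g W hlap he hG hschur hg hW s hs (lt_of_lt_of_le hss (min_le_left _ _)) i 0
  have hd := h2 lap e G schur g W hlap he hG hschur hg hW s hs (lt_of_lt_of_le hss (min_le_right _ _)) i
  classical
  -- signs `u_j = ±1`
  have habs1 : ∀ j : Fin (N + 1), |(if j.val = N then (-1 : ℝ) else 1)| = 1 := fun j => by split_ifs <;> simp
  -- split the row sum into the diagonal term and the off-diagonal ones
  rw [← Finset.add_sum_erase _ _ (Finset.mem_univ i)]
  have hdiag : |W s i i * (if i.val = N then -1 else 1)| ≤ C := by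
    rw [abs_mul, habs1 i, mul_one]; exact hd
  have hoff : |∑ j ∈ Finset.univ.erase i, W s i j * (if j.val = N then -1 else 1)| ≤ τ 0 := by
    refine (Finset.abs_sum_le_sum_abs _ _).trans (le_trans ?_ hb)
    have hsub : ∑ j ∈ Finset.univ.erase i, |W s i j * (if j.val = N then -1 else 1)| =
        ∑ j ∈ Finset.univ.erase i, (if ((0 : ℕ) : ℝ) < |(i.val : ℝ) - j.val| then |W s i j| else 0) := by
      refine Finset.sum_congr rfl fun j hj => ?_
      have hji : j ≠ i := Finset.ne_of_mem_erase hj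
      have hne : (i.val : ℝ) - j.val ≠ 0 := by
        intro h
        apply hji
        have : (i.val : ℝ) = j.val := sub_eq_zero.1 h
        exact Fin.ext (by exact_mod_cast this.symm)
      have hpos : ((0 : ℕ) : ℝ) < |(i.val : ℝ) - j.val| := by
        rw [Nat.cast_zero]; exact abs_pos.2 hne
      rw [if_pos hpos, abs_mul, habs1 j, mul_one]
    rw [hsub]
    refine Finset.sum_le_sum_of_subset_of_nonneg (Finset.erase_subset _ _) fun j _ _ => ?_
    split_ifs
    · exact abs_nonneg _
    · exact le_rfl
  calc |W s i i * (if i.val = N then -1 else 1) + ∑ j ∈ Finset.univ.erase i, W s i j * (if j.val = N then -1 else 1)|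
      ≤ |W s i i * (if i.val = N then -1 else 1)| + |∑ j ∈ Finset.univ.erase i, W s i j * (if j.val = N then -1 else 1)| :=
        abs_add_le _ _
    _ ≤ C + τ 0 := add_le_add hdiag hoff

/-- **Modulo {(U′), (L), diagonal bound} the crux is (Q1) ∧ (Q2).** -/
theorem robinCoercivity_iff_residues' (hU : BlockBandDomination) (hL : BlockBulkLimit) (hD : BlockDiagBound) :
    RobinCoercivity ↔ (BulkSymbolPositivity ∧ CornerCoercivity) :=
  robinCoercivity_iff_residues hU hL (fluxRowBound_of_band_diag hU hD)

end Summit.AtomisticToContinuum.FouriersLaw.Theorems.HonestZwanzig.Robin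

end
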